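import Literature.Computability.Complexity.Promise
import Literature.Computability.Complexity.RandomizedProofs
import Literature.Computability.Complexity.MapFstMachine
import Literature.Computability.Complexity.CoinTruncation
import Literature.Computability.Complexity.CountingHierarchyProofs
import Literature.Computability.MetaComplexity.RandReductions
import Literature.Computability.MetaComplexity.HeuristicClassesProofs
import HarnessLib

/-!
# Complexity meta: randomized reductions from promise problems, and their composition with
Karp reductions

Trunk `CplxMeta`, support for Hirahara's NP-hardness proofs of partial meta-complexity problems
(`Literature/Computability/MetaComplexity/CMMSA.lean`,
`Literature/Computability/Complexity/MCSPHardness.lean`): such proofs reduce every `L ∈ NP`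
*deterministically* to a promise (gap) problem `Q` that is NP-hard by a PCP theorem, and then
give one *randomized* polynomial-time many-one reduction from `Q` to the target language
(Hirahara, FOCS 2022, proof of Thm. 8.5: "Combining NP-hardness of CMMSA (Theorem 5.2) … with
the reduction of Lemma 8.3, we obtain a reduction from `L ∈ NP`"). This file supplies the notion
and the composition step, proved:

* `PromiseRandReducible Q₁ Q₂` — randomized polynomial-time many-one reducibility of promise
  problems with two-sided bounded error, in Arora–Barak's normal form `M(x, r)`,
  `r ∈ {0,1}^{q(|x|)}` (the algorithm reads *exactly* `q(|x|)` coins for a polynomial `q`);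
* `PromiseProblem.PolyTimeReducible.promiseRandReducible` — deterministic ⇒ randomized;
* `PromiseRandReducible.polyTimeRandReducible` — on languages (trivial promises) it implies
  G14's `PolyTimeRandReducible` (`RandReductions.lean`);
* `PromiseRandReducible.of_polyTimeReducible_left` — **composition**: a Karp reduction
  `Q₀ → Q₁` followed by a randomized reduction `Q₁ → Q₂` is a randomized reduction `Q₀ → Q₂`;
* `IsRandHard.of_isHard_promise` — hence a language to which a `C`-hard (Karp) promise problem
  randomly reduces is `C`-hard under randomized reductions (`IsRandHard`, `RandReductions.lean`);
  in particular `IsRandNPHard`.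

## Proof architecture (composition)

Given `f ∈ FP` reducing `Q₀` to `Q₁` and a PPT `A` with coin budget `q(n)` reducing `Q₁` to
`Q₂`, the composite algorithm is `A.precomp f q P`:
`run x r := A.run (f x) (r ↾ coinLen_A |f x|)` with budget `q(P(|x|))`, where `P` bounds the
output length of `f` (`exists_poly_length_le_of_mem_FP`, `CountingHierarchyProofs.lean`: a machine
halting in `p(n)` steps writes `≤ n + D·p(n)` symbols, `OutputsWithin.length_le`). Since `q` is monotone
(`polynomial_eval_mono`), `q(|f x|) ≤ q(P(|x|))`, and the first `q(|f x|)` coins of a uniform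
string of length `q(P(|x|))` are uniform (`map_take_uniformOfFintype_vector`,
`HeuristicClassesProofs.lean`), so `A.precomp f q P` has on `x` exactly the output distribution
of `A` on `f x` (`RandAlg.outputPMF_precomp`). It is polynomial time as the composite
(`PolyTimeComputable.comp_holds`, `TimeBoundsProofs.lean`) of `⟨x, r⟩ ↦ ⟨f x, r⟩`
(`mapFstFn_mem_FP`, `MapFstMachine.lean`), the coin clock `⟨u, r⟩ ↦ ⟨u, r ↾ q(|u|)⟩`
(`polyTimeComputable_boolPair_take_holds`, `CoinTruncation.lean`) and the machine of `A`
(`RandAlg.isPolyTime_precomp`). The normal form "exactly `q(|x|)` coins" is what makes the cut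
point `q(|f x|)` computable; G01's `RandAlg` allows an arbitrary (possibly non-computable) coin
budget, for which this composition is not available (cf. the design notes of
`RandReductions.lean` and `RandAlg.truncate` in `ProbabilisticClasses.lean`).

## Design notes

* `PromiseRandReducible` is the promise-problem analogue of `Literature.Computability.MetaComplexity.PolyTimeRandReducible`
  *plus* the exact-polynomial coin budget `∀ n, A.coinLen n = q.eval n` (the clause of
  `PromiseBPP'` in `Promise.lean` and of Arora–Barak, Def. 7.3); every randomized
  polynomial-time machine in the papers' online-coin sense has this form (pad the random tape
  to the running time). The statement file `Literature/Algebra/EuclideanLattices/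
  LatticeComplexity.lean` has a local glue notion `PromiseProblem.RandPolyTimeReducible`
  without the budget clause (not imported here: it would pull the lattice and quantum
  preludes into meta-complexity); `PromiseRandReducible Q₁ Q₂` implies it verbatim. The one-line
  bridge `PromiseRandReducible → RandPolyTimeReducible` (drop the budget clause) and the
  unification of the three name patterns `PolyTimeRandReducible` / `RandPolyTimeReducible` /
  `PromiseRandReducible` are deliberately left to a librarian refactor item (they need the
  lattice file's notion relocated under `Computability/` first).
* Success probability `2/3` on the promise only (nothing off the promise), two-sided, as in
  Arora–Barak, Def. 7.16, and Hirahara 2022, Thm. 8.5.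
* Mathlib has only the untimed deterministic `ManyOneReducible`; no randomized or promise
  reductions (searched `Reducible`, `Promise`, `randomi`).

## References

* S. Arora, B. Barak, *Computational Complexity: A Modern Approach*, CUP 2009: Def. 7.3
  (`M(x, r)`, `r ∈ {0,1}^{p(|x|)}`), Def. 7.16 and §7.6 (randomized reductions), Thm. 2.8
  (transitivity of polynomial-time reductions: composition).
* O. Goldreich, *On promise problems: a survey*, LNCS 3895 (2006), Def. 1.4 (reductions among
  promise problems), §1.2.
* S. Hirahara, *NP-hardness of learning programs and partial MCSP*, FOCS 2022 (ECCC TR22-119),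
  Thm. 8.5 and its proof (randomized many-one reductions obtained by composing a Karp reduction
  to the gap problem CMMSA with one randomized reduction).
-/

namespace Literature.Computability.MetaComplexity

open _root_.Computability Polynomial Complexity MetaComplexity Complexity.PromiseProblem

open scoped Complexity.Notation

/-! ### Randomized reductions between promise problems -/

/-- `PromiseRandReducible Q₁ Q₂`: the promise problem `Q₁` reduces to the promise problem `Q₂`
by a randomized polynomial-time many-one reduction with two-sided bounded error — there is a
probabilistic polynomial-time algorithm `A : {0,1}* × {0,1}^{q(n)} → {0,1}*`, reading exactly
`q(|x|)` coins for some polynomial `q` (Arora–Barak's `M(x, r)` normal form), such that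
`x ∈ Q₁.yes → Pr_r[A(x; r) ∈ Q₂.yes] ≥ 2/3` and `x ∈ Q₁.no → Pr_r[A(x; r) ∈ Q₂.no] ≥ 2/3`
(nothing is required off the promise of `Q₁`). [Arora–Barak 2009, Def. 7.16 with Def. 7.3;
Goldreich 2006, Def. 1.4; Hirahara FOCS 2022, Thm. 8.5] [cite: AroraBarak2009, Def. 7.16 and Def. 7.3] -/
def PromiseRandReducible (Q₁ Q₂ : PromiseProblem) : Prop :=
  ∃ A : RandAlg (List Bool) (List Bool),
    A.IsPolyTime id (id : List Bool → List Bool) ∧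
      (∃ q : Polynomial ℕ, ∀ n, A.coinLen n = q.eval n) ∧
        (∀ x ∈ Q₁.yes, (2 / 3 : ℝ) ≤ A.pr id x Q₂.yes) ∧
          ∀ x ∈ Q₁.no, (2 / 3 : ℝ) ≤ A.pr id x Q₂.no

/-- Unfolding lemma for `PromiseRandReducible`. [Arora–Barak 2009, Def. 7.16] [cite: AroraBarak2009, Def. 7.16] -/
theorem promiseRandReducible_iff {Q₁ Q₂ : PromiseProblem} :
    PromiseRandReducible Q₁ Q₂ ↔
      ∃ A : RandAlg (List Bool) (List Bool),
        A.IsPolyTime id (id : List Bool → List Bool) ∧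
          (∃ q : Polynomial ℕ, ∀ n, A.coinLen n = q.eval n) ∧
            (∀ x ∈ Q₁.yes, (2 / 3 : ℝ) ≤ A.pr id x Q₂.yes) ∧
              ∀ x ∈ Q₁.no, (2 / 3 : ℝ) ≤ A.pr id x Q₂.no :=
  Iff.rfl

/-- A deterministic promise reduction is a randomized one: run `f ∈ FP` coin-free
(`RandAlg.ofDet f`, budget `0 = eval 0`, correct with probability `1`; polynomial time by
`RandAlg.IsPolyTime.ofDet_holds`). [Arora–Barak 2009, §7.1 (P ⊆ BPP) and §7.6] [cite: AroraBarak2009, §7.6] -/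
theorem _root_.Literature.Computability.Complexity.PromiseProblem.PolyTimeReducible.promiseRandReducible
    {Q₁ Q₂ : PromiseProblem} (h : Q₁.PolyTimeReducible Q₂) :
    PromiseRandReducible Q₁ Q₂ := by
  classical
  obtain ⟨f, hf, hy, hn⟩ := h
  refine ⟨RandAlg.ofDet f, RandAlg.IsPolyTime.ofDet_holds hf,
    ⟨0, fun n => by simp [RandAlg.ofDet]⟩, fun x hx => ?_, fun x hx => ?_⟩
  · rw [RandAlg.pr_ofDet, if_pos (hy hx)]
    norm_num
  · rw [RandAlg.pr_ofDet, if_pos (hn hx)]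
    norm_num

/-- Promise Karp reducibility is reflexive, hence so is `PromiseRandReducible`.
[Arora–Barak 2009, Thm. 2.8] [cite: AroraBarak2009, Thm. 2.8] -/
theorem promiseRandReducible_refl (Q : PromiseProblem) : PromiseRandReducible Q Q :=
  (PolyTimeReducible.refl Q).promiseRandReducible

/-- On languages (trivial promises) a `PromiseRandReducible` reduction is a randomized reduction
in the sense of `PolyTimeRandReducible` (`RandReductions.lean`): the two one-sided guarantees
merge into `Pr_r[(A(x; r) ∈ L₂ ↔ x ∈ L₁)] ≥ 2/3`, and the budget clause is forgotten.
[Arora–Barak 2009, Def. 7.16] [cite: AroraBarak2009, Def. 7.16] -/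
theorem PromiseRandReducible.polyTimeRandReducible {L₁ L₂ : Language Bool}
    (h : PromiseRandReducible (ofLanguage L₁) (ofLanguage L₂)) : PolyTimeRandReducible L₁ L₂ := by
  obtain ⟨A, hA, -, hy, hn⟩ := h
  refine ⟨A, hA, fun x => ?_⟩
  by_cases hx : x ∈ L₁
  · have hset : {y : List Bool | y ∈ L₂ ↔ x ∈ L₁} = (ofLanguage L₂).yes := by
      ext y
      show (y ∈ L₂ ↔ x ∈ L₁) ↔ y ∈ L₂
      exact ⟨fun h => h.2 hx, fun h => ⟨fun _ => hx, fun _ => h⟩⟩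
    rw [hset]
    exact hy x hx
  · have hset : {y : List Bool | y ∈ L₂ ↔ x ∈ L₁} = (ofLanguage L₂).no := by
      ext y
      show (y ∈ L₂ ↔ x ∈ L₁) ↔ y ∉ L₂
      exact ⟨fun h hy' => hx (h.1 hy'),
        fun h => ⟨fun hy' => (h hy').elim, fun hx' => (hx hx').elim⟩⟩
    rw [hset]
    exact hn x hx

end Literature.Computability.MetaComplexity

/-! ### Precomposing a randomized algorithm with a deterministic map -/

namespace Literature.Computability.Complexity.RandAlg

open _root_.Computability Polynomial MetaComplexity

/-- `A.precomp f q P`: first apply the (deterministic) map `f`, then run `A` on `f x` with the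
first `coinLen_A |f x|` of the coins; the coin budget on inputs of length `n` is `q(P(n))`
(intended: `q` the exact budget of `A`, `P` an output-length bound of `f`, so that enough coins
are available). This is the composite reduction of Arora–Barak's transitivity argument
(Thm. 2.8) with a randomized second stage. [Arora–Barak 2009, Thm. 2.8 and §7.6] [cite: AroraBarak2009, §7.6] -/
def precomp (A : RandAlg (List Bool) (List Bool)) (f : List Bool → List Bool)
    (q P : Polynomial ℕ) : RandAlg (List Bool) (List Bool) where
  run x r := A.run (f x) (r.take (A.coinLen (f x).length))
  coinLen n := q.eval (P.eval n)

/-- The run map of `A.precomp f q P` (definitional). [folklore] -/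
@[simp] theorem precomp_run (A : RandAlg (List Bool) (List Bool)) (f : List Bool → List Bool)
    (q P : Polynomial ℕ) (x r : List Bool) :
    (A.precomp f q P).run x r = A.run (f x) (r.take (A.coinLen (f x).length)) :=
  rfl

/-- The coin budget of `A.precomp f q P` is the polynomial `q ∘ P` (definitional). [folklore] -/
@[simp] theorem precomp_coinLen (A : RandAlg (List Bool) (List Bool)) (f : List Bool → List Bool)
    (q P : Polynomial ℕ) (n : ℕ) : (A.precomp f q P).coinLen n = (q.comp P).eval n := by
  simp [precomp, eval_comp]

/-- **Output distribution of the composite.** If `A` reads exactly `q(n)` coins and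
`|f x| ≤ P(|x|)`, then `A.precomp f q P` has on `x` the output distribution of `A` on `f x`:
`q(|f x|) ≤ q(P(|x|))` by monotonicity, and a prefix of a uniform coin string is uniform
(`map_take_uniformOfFintype_vector`). [Arora–Barak 2009, Def. 7.3 and Thm. 2.8] [cite: AroraBarak2009, §7.6] -/
theorem outputPMF_precomp (A : RandAlg (List Bool) (List Bool)) {f : List Bool → List Bool}
    {q P : Polynomial ℕ} (hq : ∀ n, A.coinLen n = q.eval n)
    (hP : ∀ x, (f x).length ≤ P.eval x.length) (x : List Bool) :
    (A.precomp f q P).outputPMF id x = A.outputPMF id (f x) := by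
  have hle : A.coinLen (f x).length ≤ (A.precomp f q P).coinLen x.length := by
    show A.coinLen (f x).length ≤ q.eval (P.eval x.length)
    rw [hq]
    exact polynomial_eval_mono q (hP x)
  simp only [outputPMF, id]
  have h1 : (fun r : List.Vector Bool ((A.precomp f q P).coinLen x.length) =>
        (A.precomp f q P).run x r.toList) =
      (fun s : List Bool => A.run (f x) s) ∘ fun r => r.toList.take (A.coinLen (f x).length) := by
    funext r
    rfl
  have h2 : (fun r : List.Vector Bool (A.coinLen (f x).length) => A.run (f x) r.toList) =
      (fun s : List Bool => A.run (f x) s) ∘ List.Vector.toList := rfl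
  rw [h1, h2, ← PMF.map_comp, ← PMF.map_comp, map_take_uniformOfFintype_vector hle]

/-- Probabilities of events under the composite are those of `A` on `f x`
(from `outputPMF_precomp`). [Arora–Barak 2009, §7.6] [cite: AroraBarak2009, §7.6] -/
theorem pr_precomp (A : RandAlg (List Bool) (List Bool)) {f : List Bool → List Bool}
    {q P : Polynomial ℕ} (hq : ∀ n, A.coinLen n = q.eval n)
    (hP : ∀ x, (f x).length ≤ P.eval x.length) (x : List Bool) (E : Set (List Bool)) :
    (A.precomp f q P).pr id x E = A.pr id (f x) E := by
  simp only [pr, outputPMF_precomp A hq hP]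

/-- **The composite is polynomial time**: `⟨x, r⟩ ↦ A.run (f x) (r ↾ q(|f x|))` is the composite
of `⟨x, r⟩ ↦ ⟨f x, r⟩` (`mapFstFn_mem_FP`), the coin clock `⟨u, r⟩ ↦ ⟨u, r ↾ q(|u|)⟩`
(`polyTimeComputable_boolPair_take_holds`) and the machine of `A`
(`PolyTimeComputable.comp_holds`); the budget `q ∘ P` is a polynomial.
[Arora–Barak 2009, Thm. 2.8 (proof) and Def. 7.3] [cite: AroraBarak2009, Thm. 2.8 (proof)] -/
theorem isPolyTime_precomp {A : RandAlg (List Bool) (List Bool)} {f : List Bool → List Bool}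
    {q : Polynomial ℕ} (hA : A.IsPolyTime id (id : List Bool → List Bool))
    (hq : ∀ n, A.coinLen n = q.eval n) (hf : f ∈ FP) (P : Polynomial ℕ) :
    (A.precomp f q P).IsPolyTime id (id : List Bool → List Bool) := by
  refine ⟨?_, q.comp P, fun n => (precomp_coinLen A f q P n).le⟩
  -- stage 1: `⟨x, r⟩ ↦ ⟨f x, r⟩` on pairs, transported from the string map `mapFstFn f`
  have h₁ : PolyTimeComputable (Function.uncurry boolPair) (Function.uncurry boolPair)
      (fun p : List Bool × List Bool => (f p.1, p.2)) :=
    PolyTimeComputable.of_encode_eq (f := mapFstFn f) (ea := id) (eb := id)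
      (Function.uncurry boolPair) (fun _ => rfl) (fun p => by simp [Function.uncurry])
      (mapFstFn_mem_FP hf)
  -- stage 2: the coin clock `⟨u, r⟩ ↦ ⟨u, r ↾ q(|u|)⟩`, i.e. `r ↾ coinLen_A |u|`
  have h₂ : PolyTimeComputable (Function.uncurry boolPair) (Function.uncurry boolPair)
      (fun p : List Bool × List Bool => (p.1, p.2.take (A.coinLen p.1.length))) :=
    PolyTimeComputable.of_encode_eq
      (f := fun p : List Bool × List Bool => (p.1, p.2.take (q.eval p.1.length)))
      (id : List Bool × List Bool → List Bool × List Bool) (fun _ => rfl)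
      (fun p => by simp [Function.uncurry, hq]) (polyTimeComputable_boolPair_take_holds q)
  -- stage 3: the machine of `A` on pairs
  have h₃ : PolyTimeComputable (Function.uncurry boolPair) (id : List Bool → List Bool)
      (Function.uncurry A.run) := hA.1
  have h := PolyTimeComputable.comp_holds (PolyTimeComputable.comp_holds h₃ h₂) h₁
  exact PolyTimeComputable.of_encode_eq (id : List Bool × List Bool → List Bool × List Bool)
    (fun _ => rfl) (fun _ => rfl) h

end Literature.Computability.Complexity.RandAlg

namespace Literature.Computability.MetaComplexity

open _root_.Computability Polynomial Complexity MetaComplexity Complexity.PromiseProblem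

open scoped Complexity.Notation

/-! ### Composition with Karp reductions and transfer of hardness -/

/-- **Karp then randomized is randomized.** If `Q₀` Karp-reduces to `Q₁` (`f ∈ FP` mapping yes
to yes and no to no) and `Q₁` randomly reduces to `Q₂` by `A` with exact polynomial coin budget
`q`, then `A.precomp f q P` (with `P` an output-length bound of `f`) randomly reduces `Q₀` to
`Q₂`: on `x` it has the output distribution of `A` on `f x` (`RandAlg.pr_precomp`), and `f x`
lies in the promise part of `Q₁` matching that of `x`. [Arora–Barak 2009, Thm. 2.8 (transitivity)
and §7.6; Hirahara FOCS 2022, proof of Thm. 8.5] [cite: AroraBarak2009, §7.6 and Thm. 2.8] -/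
theorem PromiseRandReducible.of_polyTimeReducible_left {Q₀ Q₁ Q₂ : PromiseProblem}
    (h₀₁ : Q₀.PolyTimeReducible Q₁) (h₁₂ : PromiseRandReducible Q₁ Q₂) :
    PromiseRandReducible Q₀ Q₂ := by
  obtain ⟨f, hf, hy, hn⟩ := h₀₁
  obtain ⟨A, hA, ⟨q, hq⟩, hAy, hAn⟩ := h₁₂
  obtain ⟨P, hP⟩ := exists_poly_length_le_of_mem_FP hf
  refine ⟨A.precomp f q P, RandAlg.isPolyTime_precomp hA hq hf P,
    ⟨q.comp P, RandAlg.precomp_coinLen A f q P⟩, fun x hx => ?_, fun x hx => ?_⟩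
  · rw [RandAlg.pr_precomp A hq hP]
    exact hAy (f x) (hy hx)
  · rw [RandAlg.pr_precomp A hq hP]
    exact hAn (f x) (hn hx)

/-- **Transfer of hardness.** If the promise problem `Q` is `C`-hard under Karp reductions
(`PromiseProblem.IsHard`, e.g. NP-hard by a PCP theorem) and `Q` randomly reduces to the
language `L` (as the promise problem `ofLanguage L`), then `L` is `C`-hard under randomized
polynomial-time many-one reductions (`IsRandHard C L`, `RandReductions.lean`). This is the shape
of Hirahara's proof of Thm. 8.5 (NP --Karp--> CMMSA --randomized--> MCSP*).
[Arora–Barak 2009, §7.6; Hirahara FOCS 2022, proof of Thm. 8.5] [cite: AroraBarak2009, §7.6] -/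
theorem IsRandHard.of_isHard_promise {C : Set (Language Bool)}
    {Q : PromiseProblem} {L : Language Bool} (hQ : Q.IsHard C)
    (h : PromiseRandReducible Q (ofLanguage L)) : IsRandHard C L :=
  fun L' hL' => (PromiseRandReducible.of_polyTimeReducible_left (hQ L' hL') h).polyTimeRandReducible

/-- NP-hardness version of `IsRandHard.of_isHard_promise`: a language to which an NP-hard
promise problem randomly reduces is NP-hard under randomized reductions (`IsRandNPHard`).
[Arora–Barak 2009, §7.6; Hirahara FOCS 2022, Thm. 8.5] [cite: AroraBarak2009, §7.6] -/
theorem IsRandNPHard.of_isNPHard_promise {Q : PromiseProblem}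
    {L : Language Bool} (hQ : Q.IsNPHard) (h : PromiseRandReducible Q (ofLanguage L)) :
    IsRandNPHard L :=
  IsRandHard.of_isHard_promise hQ h

/-- Randomized hardness of promise problems themselves propagates along `PromiseRandReducible`
on the right of a *Karp*-hard problem: if `Q` is `C`-hard (Karp) and `PromiseRandReducible Q Q'`
then every `L' ∈ C` satisfies `PromiseRandReducible (ofLanguage L') Q'`.
[Arora–Barak 2009, §7.6 and Thm. 2.8] [cite: AroraBarak2009, §7.6] -/
theorem PromiseRandReducible.of_isHard {C : Set (Language Bool)} {Q Q' : PromiseProblem}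
    (hQ : Q.IsHard C) (h : PromiseRandReducible Q Q') {L' : Language Bool} (hL' : L' ∈ C) :
    PromiseRandReducible (ofLanguage L') Q' :=
  PromiseRandReducible.of_polyTimeReducible_left (hQ L' hL') h

end Literature.Computability.MetaComplexity
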